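import Summits.ValiantsHypothesis.ValiantsHypothesis.Theorems.BarrierLeverPartitionMinorsTwinSplit
import Summits.ValiantsHypothesis.ValiantsHypothesis.Theorems.BarrierLeverPartitionMinorsChowPeel
import Mathlib.Algebra.Polynomial.Roots

/-!
# Route BarrierLever — Chow witnesses for partition minors (items 20172 / 20195): preliminaries for the
# TWIN-BALANCED SPLIT — the deformation lemma, the gadget `g_δ`, lifted faces

Helper file (`--supports stmt-ValiantsHypothesis-20172`; cell valiant-natproofs, rung V4, 𝒟-side of
door (c); seat valiant-natproofs-prover gen 13).  Closes NO item; definition-free.  Used by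
`…PartitionMinorsTwinBalancedSplit` (`chow_twinBalancedSplit`, `chow_hit_double`).

* `exists_ne_zero_and_det_add_smul_ne_zero` — **deformation lemma**: if `det X₀ ≠ 0` then
  `det (X₀ + δ • X₁) ≠ 0` for some `δ ≠ 0` (the polynomial `δ ↦ det (X₀ + δ X₁)` over `ℂ[δ]` has the
  nonzero value `det X₀` at `0`, hence finitely many roots; `ℂ` is infinite).  This is what lets a
  block reduction survive a perturbation that is only triangular AT `δ = 0`.
* `coeff_balancedGadget` — the two-form gadget `g_δ = (1 + x_a - δ y_c)(1 + (1 + δ) y_c)` has the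
  multilinear site table `[[1, 1], [1, 1 + δ]]` on `{1, x_a} × {1, y_c}` (via
  `coeff_partitionExpo_mul_affine` / `coeff_partitionExpo_affine` of `…YOnlyFactor`);
  `support_balancedGadget` — it involves only `x_a, y_c` (bookkeeping via `affine_xy_eq`,
  `vars_affine_xy_subset` of `…ChowPeel`).
* `preimage_succAbove_map`, `preimage_succAbove_insert_map`, `not_mem_map_succAboveEmb` — pulling a
  lifted face `S↑ = S.map (succAboveEmb a)` (or `insert a S↑`) back along `a.succAbove` gives `S`.

WHAT THIS IS NOT: bookkeeping only; nothing on items 20195 / 20172 / 19717 themselves, on crux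
stmt-ValiantsHypothesis-14610, or on `VP` versus `VNP`.
-/

set_option linter.dupNamespace false

namespace Summit.ValiantsHypothesis.ValiantsHypothesis.Theorems.BarrierLever.ChowFactor

open Finset MvPolynomial

noncomputable section

variable {h : ℕ}

/-! ## 1. A determinant nonzero at `δ = 0` is nonzero at some `δ ≠ 0` -/

/-- **Deformation lemma.**  If `det X₀ ≠ 0` then `det (X₀ + δ • X₁) ≠ 0` for some `δ ≠ 0`: the
polynomial `δ ↦ det (X₀ + δ X₁)` is nonzero (its value at `0` is `det X₀`), so it has finitely many
roots, and `ℂ` is infinite. -/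
theorem exists_ne_zero_and_det_add_smul_ne_zero {ι : Type*} [Fintype ι] [DecidableEq ι]
    (X₀ X₁ : Matrix ι ι ℂ) (h₀ : X₀.det ≠ 0) : ∃ δ : ℂ, δ ≠ 0 ∧ (X₀ + δ • X₁).det ≠ 0 := by
  classical
  set p : Polynomial ℂ :=
    (X₀.map Polynomial.C + (Polynomial.X : Polynomial ℂ) • X₁.map Polynomial.C).det with hp
  have heval : ∀ δ : ℂ, p.eval δ = (X₀ + δ • X₁).det := by
    intro δ
    rw [hp, ← Polynomial.coe_evalRingHom, RingHom.map_det]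
    congr 1
    ext i j
    simp [RingHom.mapMatrix_apply, Matrix.map_apply, Matrix.add_apply, Matrix.smul_apply]
    ring
  have hp0 : p ≠ 0 := by
    intro hz
    apply h₀
    have e := heval 0
    rw [hz, Polynomial.eval_zero, zero_smul, add_zero] at e
    exact e.symm
  obtain ⟨δ, hδ⟩ := Infinite.exists_notMem_finset (insert (0 : ℂ) p.roots.toFinset)
  rw [Finset.mem_insert, not_or, Multiset.mem_toFinset, Polynomial.mem_roots hp0,
    Polynomial.IsRoot.def, heval] at hδ
  exact ⟨δ, hδ.1, hδ.2⟩

/-! ## 2. The gadget `g_δ = (1 + x_a - δ y_c)(1 + (1 + δ) y_c)` -/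

/-- The gadget `g_δ` involves only `x_a` and `y_c`. -/
theorem support_balancedGadget (a c : Fin (h + 1)) (δ : ℂ) :
    ∀ m ∈ ((C 1 + C 1 * X (Fin.castAdd (h + 1) a) + C (-δ) * X (Fin.natAdd (h + 1) c)) *
        (C 1 + C 0 * X (Fin.castAdd (h + 1) a) + C (1 + δ) * X (Fin.natAdd (h + 1) c)) :
        MvPolynomial (Fin ((h + 1) + (h + 1))) ℂ).support,
      ∀ v, ¬ (v = Fin.castAdd (h + 1) a ∨ v = Fin.natAdd (h + 1) c) → m v = 0 := by
  classical
  intro m hm v hv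
  by_contra hne
  have hvars : v ∈ ((C 1 + C 1 * X (Fin.castAdd (h + 1) a) + C (-δ) * X (Fin.natAdd (h + 1) c)) *
      (C 1 + C 0 * X (Fin.castAdd (h + 1) a) + C (1 + δ) * X (Fin.natAdd (h + 1) c)) :
      MvPolynomial (Fin ((h + 1) + (h + 1))) ℂ).vars :=
    (mem_vars_iff_mem_support v).mpr ⟨m, hm, Finsupp.mem_support_iff.mpr hne⟩
  have hv' := (vars_mul _ _).trans (Finset.union_subset (vars_affine_xy_subset a c 1 (-δ))
    (vars_affine_xy_subset a c 0 (1 + δ))) hvars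
  simp only [Finset.mem_insert, Finset.mem_singleton] at hv'
  exact hv hv'

/-- **The four multilinear coefficients of the gadget**: `1` at `(∅, ∅)`, `({a}, ∅)`, `(∅, {c})` and
`1 + δ` at `({a}, {c})` — the site table `[[1, 1], [1, 1 + δ]]`. -/
theorem coeff_balancedGadget (a c : Fin (h + 1)) (δ : ℂ) (U W : Finset (Fin (h + 1)))
    (hU : U = ∅ ∨ U = {a}) (hW : W = ∅ ∨ W = {c}) :
    coeff (∑ a' ∈ U, Finsupp.single (Fin.castAdd (h + 1) a') 1 +
        ∑ c' ∈ W, Finsupp.single (Fin.natAdd (h + 1) c') 1)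
      ((C 1 + C 1 * X (Fin.castAdd (h + 1) a) + C (-δ) * X (Fin.natAdd (h + 1) c)) *
        (C 1 + C 0 * X (Fin.castAdd (h + 1) a) + C (1 + δ) * X (Fin.natAdd (h + 1) c)) :
        MvPolynomial (Fin ((h + 1) + (h + 1))) ℂ) =
      if U = {a} ∧ W = {c} then 1 + δ else 1 := by
  classical
  rw [← affine_xy_eq a c 0 (1 + δ), coeff_partitionExpo_mul_affine, ← affine_xy_eq a c 1 (-δ)]
  simp_rw [coeff_partitionExpo_affine]
  have hane : ({a} : Finset (Fin (h + 1))) ≠ ∅ := Finset.singleton_ne_empty a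
  have hcne : ({c} : Finset (Fin (h + 1))) ≠ ∅ := Finset.singleton_ne_empty c
  rcases hU with rfl | rfl <;> rcases hW with rfl | rfl
  all_goals simp [hane, hcne, hane.symm, hcne.symm, Finset.sum_singleton]

/-! ## 3. Lifted faces pulled back -/

/-- The new coordinate is not in a lifted face. -/
theorem not_mem_map_succAboveEmb (a : Fin (h + 1)) (S : Finset (Fin h)) :
    a ∉ S.map (Fin.succAboveEmb a) := by
  intro ha
  obtain ⟨b, -, hb⟩ := Finset.mem_map.mp ha
  exact Fin.succAbove_ne a b hb

/-- Pulling a lifted face back along `a.succAbove` recovers it. -/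
theorem preimage_succAbove_map (a : Fin (h + 1)) (S : Finset (Fin h)) :
    (S.map (Fin.succAboveEmb a)).preimage a.succAbove Fin.succAbove_right_injective.injOn = S := by
  ext b
  simp only [Finset.mem_preimage, Finset.mem_map, Fin.succAboveEmb_apply]
  constructor
  · rintro ⟨b', hb', e⟩
    rwa [← Fin.succAbove_right_injective e]
  · intro hb
    exact ⟨b, hb, rfl⟩

/-- Pulling back `insert a` of a lifted face along `a.succAbove` recovers the face. -/
theorem preimage_succAbove_insert_map (a : Fin (h + 1)) (S : Finset (Fin h)) :
    (insert a (S.map (Fin.succAboveEmb a))).preimage a.succAbove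
      Fin.succAbove_right_injective.injOn = S := by
  ext b
  rw [Finset.mem_preimage, Finset.mem_insert, ← Finset.mem_preimage (hf := Fin.succAbove_right_injective.injOn),
    preimage_succAbove_map]
  constructor
  · rintro (e | hb)
    · exact absurd e (Fin.succAbove_ne a b)
    · exact hb
  · exact Or.inr


end

end Summit.ValiantsHypothesis.ValiantsHypothesis.Theorems.BarrierLever.ChowFactor
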